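import Literature.AnabelianGeometry.EtaleTheta.BiKummerThm44SubModelConnectedBinj
import Literature.AnabelianGeometry.EtaleTheta.BiKummerThm44SubNHSatRootsReading

/-!
# [EtTh] Theorem 4.4 (i)(ii)(iii) at the GENUINE connected base, ROOTS READING of the `(N,H)`-saturation slot:
# ⇐ {`hBinj₁`, `hBinj₂`} and nothing else (proof-only)

S. Mochizuki, *The étale theta function and its Frobenioid-theoretic manifestations*, Publ. RIMS **45** (2009)
[MochizukiEtTh2009], §4, Thm 4.4 (i)–(iii), PDF p.94 (printed p.320), proof PDF p.95.  abc-iut cell, layer L2,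
plan/L2/SUBDAG-EtTh-Thm44.md (custodian lineage abc-iut-w5-d179), cone nodes `EtTh:Thm4.4(i)`, `EtTh:Thm4.4(ii)`,
`EtTh:Thm4.4(iii)`.  Seat abc-iut-w5-d179 (gen 4).  PROOF-ONLY (0 `def`s, no `Prop` facts, no instances); one
composition; nothing landed is edited or restated.

`BiKummerThm44SubModelConnectedBinj.lean` (p434227, this seat) gives Thm 4.4 (i) ∧ (ii) ∧ (iii)-saturation ∧ (`N`-th
roots) for abc-iut-L2-t4's settings `mkOfConnectedTemperoid` over the genuine base `B^temp(Π^tp_{X_i})⁰` ⇐ {`hBinj₁`,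
`hBinj₂`, T44-L15b}, the binder census {Rmk 3.7.2, `hBmon`} ↦ {`hBinj`} (`hBinj_i` : pull-backs of the Def 3.6 (i)
datum `B₀^Λ` injective, Def 3.3 (iii)).  abc-iut-w4-d044's `preservesNHSaturatedBsFld_rootsReading` (p431503)
discharges T44-L15b when BOTH free `(N, H_⊙^{bs-fld})`-saturation slots carry the ROOTS READING (HONEST LABEL:
«`Div_B`-trivial elements of `B_i(A_{⊙,i}^bs)` acquire `N`-th roots along every `A^bs ⟶ A_{⊙,i}^bs`», the consequence
[FrdII] Rmk 2.2.1 draws from Def 2.2 (ii)(c) — WEAKER than print's cohomological definition; at the faithful reading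
T44-L15b stays an input, abc-iut-w6-d047).  Composing:

* `Thm44Hyp.thm44_mkOfConnectedTemperoid_rootsReading_of_hBinj(')` — **(i) ∧ (ii) ∧ (iii) ∧ (`N`-th roots) at the
  genuine connected base, roots reading, ⇐ {`hBinj₁`, `hBinj₂`} and NOTHING ELSE**: no plan/FACT-LIST fact, no
  sub-DAG row, no setting-field hypothesis remains (compare abc-iut-w4-d044's `thm44_mkOfConnectedTemperoid_rootsReading`,
  p432854, ⇐ {`Remark372 D₀ / D₀'`, `hBmon₁ / hBmon₂`}).

The Kummer-class clause of (iii) (T44-L16) is not included.  HONEST FRAMING: refereed pre-IUT material; a reading of a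
free interface slot, labelled in the theorem name; nothing here asserts that such data exist for an actual curve or
bears on the disputed [IUTchIII] Cor. 3.12; typed ≠ proved — here PROVED.
-/

noncomputable section

namespace Literature.AnabelianGeometry.EtaleTheta

open CategoryTheory Opposite Function Literature.AlgebraicGeometry.Frobenioids Literature.AnabelianGeometry.SemiGraphs

namespace BiKummerSetting

universe u₀ v₀ u v w

/-! ### At the genuine connected base AT THE ROOTS READING of the `(N,H)`-slot: inputs {`hBinj₁`, `hBinj₂`} ONLY -/

section ConnectedRootsReading

variable {K : Type u₀} [Field K] {K' : Type u₀} [Field K'] {X₁ : SemiGraphs.TemperedArithmeticGroup.{u₀} K}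
  {X₂ : SemiGraphs.TemperedArithmeticGroup.{u₀} K'} {D₀ : Type u₀} [Category.{v₀} D₀] {D₀' : Type u₀}
  [Category.{v₀} D₀'] {T₁ : RealifiedDivisorMonoids (D₀ := D₀) treeMonoidVocab.{w}}
  {T₂ : RealifiedDivisorMonoids (D₀ := D₀') treeMonoidVocab.{w}}
  {IsRational₁ IsStrictlyRational₁ : ((ConnectedPart (BTemp X₁.Pi))ᵒᵖ ⥤ CommMonCat.{w}) → Prop}
  {IsRational₂ IsStrictlyRational₂ : ((ConnectedPart (BTemp X₂.Pi))ᵒᵖ ⥤ CommMonCat.{w}) → Prop}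
  (tf₁ : TemperedFrobenioid T₁ (ConnectedPart (BTemp X₁.Pi))
    (treeCatVocab (ConnectedPart (BTemp X₁.Pi)) IsRational₁ IsStrictlyRational₁))
  (hZ₁ : tf₁.monoidType = MonoidType.Z) (hP₁ : ∀ A : (ConnectedPart (BTemp X₁.Pi))ᵒᵖ, IsPerfect (tf₁.Φ.carrier A))
  (A₁ : tf₁.category) (hA₁ : PreFrobenioid.IsFrobeniusTrivial tf₁.toElem A₁)
  (hA₁' : SemiGraphs.IsGaloisObj A₁.base.obj)
  (tf₂ : TemperedFrobenioid T₂ (ConnectedPart (BTemp X₂.Pi))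
    (treeCatVocab (ConnectedPart (BTemp X₂.Pi)) IsRational₂ IsStrictlyRational₂))
  (hZ₂ : tf₂.monoidType = MonoidType.Z) (hP₂ : ∀ B : (ConnectedPart (BTemp X₂.Pi))ᵒᵖ, IsPerfect (tf₂.Φ.carrier B))
  (A₂ : tf₂.category) (hA₂ : PreFrobenioid.IsFrobeniusTrivial tf₂.toElem A₂)
  (hA₂' : SemiGraphs.IsGaloisObj A₂.base.obj)

/-- **[EtTh] Thm 4.4 (i) ∧ (ii) ∧ (iii)-saturation ∧ (`N`-th roots) at the GENUINE connected base AT THE ROOTS READING of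
the `(N, H_⊙^{bs-fld})`-saturation slot ⇐ {`hBinj₁`, `hBinj₂`} and NOTHING ELSE** (`ψ = psiModel hF₁ hF₂ h3` over any
proofs): `thm44_mkOfConnectedTemperoid_of_hBinj` with its last input T44-L15b supplied by abc-iut-w4-d044's
`preservesNHSaturatedBsFld_rootsReading` (p431503; HONEST LABEL: the roots reading is the consequence [FrdII] Rmk 2.2.1
draws from Def 2.2 (ii)(c), WEAKER than print's cohomological definition — at the faithful reading T44-L15b stays an
input).  Compare abc-iut-w4-d044's `thm44_mkOfConnectedTemperoid_rootsReading` (p432854) ⇐ {`Remark372 D₀ / D₀'`,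
`hBmon₁ / hBmon₂`}. [cite: MochizukiEtTh2009, Thm 4.4 p.94] -/
theorem Thm44Hyp.thm44_mkOfConnectedTemperoid_rootsReading_of_hBinj
    (h : Thm44Hyp
      (mkOfConnectedTemperoid X₁ tf₁ hZ₁ hP₁
        (fun _ A M => ∀ (g : A.base ⟶ A₁.base) (x : tf₁.ratFnFunctor.obj (op A₁.base)),
          divB tf₁.divisorMonoid tf₁.ratFnFunctor tf₁.divBNatTrans (op A₁.base) x = 1 →
            ∃ ζ : tf₁.ratFnFunctor.obj (op A.base), ζ ^ (M : ℕ) = pull tf₁.ratFnFunctor g x)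
        A₁ hA₁ hA₁')
      (mkOfConnectedTemperoid X₂ tf₂ hZ₂ hP₂
        (fun _ A M => ∀ (g : A.base ⟶ A₂.base) (x : tf₂.ratFnFunctor.obj (op A₂.base)),
          divB tf₂.divisorMonoid tf₂.ratFnFunctor tf₂.divBNatTrans (op A₂.base) x = 1 →
            ∃ ζ : tf₂.ratFnFunctor.obj (op A.base), ζ ^ (M : ℕ) = pull tf₂.ratFnFunctor g x)
        A₂ hA₂ hA₂'))
    (hF₁ : PreFrobenioid.IsFrobenioid tf₁.toElem) (hF₂ : PreFrobenioid.IsFrobenioid tf₂.toElem)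
    (h3 : h.PreservesFrobeniusStructure)
    (hBinj₁ : ∀ {Y Y' : D₀ᵒᵖ} (g : Y ⟶ Y'), Injective (T₁.BΛ.map g).hom)
    (hBinj₂ : ∀ {Y Y' : D₀'ᵒᵖ} (g : Y ⟶ Y'), Injective (T₂.BΛ.map g).hom) :
    Thm44_i h ∧ Thm44_ii h (h.psiModel hF₁ hF₂ h3) ∧ Thm44_iii h (h.psiModel hF₁ hF₂ h3) ∧
      h.PreservesNthRoots (h.psiModel hF₁ hF₂ h3) (fun φ f => tf₁.pullFracModel φ f)
        (fun φ f => tf₂.pullFracModel φ f) :=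
  h.thm44_mkOfConnectedTemperoid_of_hBinj hF₁ hF₂ h3 hBinj₁ hBinj₂
    (Thm44Hyp.preservesNHSaturatedBsFld_rootsReading tf₁ hZ₁ hP₁ _ _ _ A₁ hA₁ hA₁' tf₂ hZ₂ hP₂ _ _ _ A₂ hA₂ hA₂' h
      hF₁ hF₂ h3)

/-- **The same with the ψ-slot proofs supplied from `hBinj`** — literally ⇐ {`hBinj₁`, `hBinj₂`} at the roots reading:
no plan/FACT-LIST fact, no sub-DAG row, no setting-field hypothesis remains an input of the three cone nodes there.
[cite: MochizukiEtTh2009, Thm 4.4 p.94] -/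
theorem Thm44Hyp.thm44_mkOfConnectedTemperoid_rootsReading_of_hBinj'
    (h : Thm44Hyp
      (mkOfConnectedTemperoid X₁ tf₁ hZ₁ hP₁
        (fun _ A M => ∀ (g : A.base ⟶ A₁.base) (x : tf₁.ratFnFunctor.obj (op A₁.base)),
          divB tf₁.divisorMonoid tf₁.ratFnFunctor tf₁.divBNatTrans (op A₁.base) x = 1 →
            ∃ ζ : tf₁.ratFnFunctor.obj (op A.base), ζ ^ (M : ℕ) = pull tf₁.ratFnFunctor g x)
        A₁ hA₁ hA₁')
      (mkOfConnectedTemperoid X₂ tf₂ hZ₂ hP₂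
        (fun _ A M => ∀ (g : A.base ⟶ A₂.base) (x : tf₂.ratFnFunctor.obj (op A₂.base)),
          divB tf₂.divisorMonoid tf₂.ratFnFunctor tf₂.divBNatTrans (op A₂.base) x = 1 →
            ∃ ζ : tf₂.ratFnFunctor.obj (op A.base), ζ ^ (M : ℕ) = pull tf₂.ratFnFunctor g x)
        A₂ hA₂ hA₂'))
    (hBinj₁ : ∀ {Y Y' : D₀ᵒᵖ} (g : Y ⟶ Y'), Injective (T₁.BΛ.map g).hom)
    (hBinj₂ : ∀ {Y Y' : D₀'ᵒᵖ} (g : Y ⟶ Y'), Injective (T₂.BΛ.map g).hom) :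
    Thm44_i h ∧
      Thm44_ii h (h.psiModel
        (tf₁.isFrobenioid_of_structural hBinj₁ fun α hα =>
          (QuasiTemperoid.BTempConnected.connectedPart_isOfFSMType (G := X₁.Pi)).isIso_of_isFSM α hα)
        (tf₂.isFrobenioid_of_structural hBinj₂ fun α hα =>
          (QuasiTemperoid.BTempConnected.connectedPart_isOfFSMType (G := X₂.Pi)).isIso_of_isFSM α hα)
        (h.preservesFrobeniusStructure_mkOfConnectedTemperoid_of_hBinj hBinj₁ hBinj₂)) ∧
      Thm44_iii h (h.psiModel
        (tf₁.isFrobenioid_of_structural hBinj₁ fun α hα =>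
          (QuasiTemperoid.BTempConnected.connectedPart_isOfFSMType (G := X₁.Pi)).isIso_of_isFSM α hα)
        (tf₂.isFrobenioid_of_structural hBinj₂ fun α hα =>
          (QuasiTemperoid.BTempConnected.connectedPart_isOfFSMType (G := X₂.Pi)).isIso_of_isFSM α hα)
        (h.preservesFrobeniusStructure_mkOfConnectedTemperoid_of_hBinj hBinj₁ hBinj₂)) ∧
      h.PreservesNthRoots (h.psiModel
        (tf₁.isFrobenioid_of_structural hBinj₁ fun α hα =>
          (QuasiTemperoid.BTempConnected.connectedPart_isOfFSMType (G := X₁.Pi)).isIso_of_isFSM α hα)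
        (tf₂.isFrobenioid_of_structural hBinj₂ fun α hα =>
          (QuasiTemperoid.BTempConnected.connectedPart_isOfFSMType (G := X₂.Pi)).isIso_of_isFSM α hα)
        (h.preservesFrobeniusStructure_mkOfConnectedTemperoid_of_hBinj hBinj₁ hBinj₂))
        (fun φ f => tf₁.pullFracModel φ f) (fun φ f => tf₂.pullFracModel φ f) :=
  Thm44Hyp.thm44_mkOfConnectedTemperoid_rootsReading_of_hBinj tf₁ hZ₁ hP₁ A₁ hA₁ hA₁' tf₂ hZ₂ hP₂ A₂ hA₂ hA₂' h _ _ _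
    hBinj₁ hBinj₂

end ConnectedRootsReading

end BiKummerSetting

end Literature.AnabelianGeometry.EtaleTheta

end
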